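import Literature.AlgebraicGeometry.Motives.HodgeStructureLefschetzGroupPoints
import HarnessLib

/-!
# "The `k`-algebra `C(A)` is generated by the `γ ∈ S(A)(k)`" (Milne 1999, proof of Prop. 3.3 / Lemma 3.5) for the abstract
# polarized `ℚ`-Hodge structure, on `ℚ`-points and on `K`-points WITHOUT algebraic closure: `ℚ[S(H)(ℚ)] = ℚ[Hg(H)(ℚ)] = C(H)`,
# `K[S(H)(K)] = K[Hg(H)(K)]` with underlying `K`-module `C(H) ⊗ K`; hence the `S(H)`-invariant endomorphisms are exactly the
# Hodge endomorphisms: `End_ℚ(V)^{S(H)(ℚ)} = E_φ`, `End_K(K ⊗ V)^{S(H)(K)} = E_φ ⊗ K`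

[topic AlgebraicGeometry/Motives]

Layer `Literature/AlgebraicGeometry/Motives`, lane `lit-hodgefound` (Track 2 foundations library; seat `lit-hodgefound-p34`,
generation 18, self-proposed row g18-#7 of `run/shared/lean/pub/lit-hodgefound/SKELETON.md`). THEOREMS ONLY (no definition,
no named fact; net debt `0`). Seventh file of the seat's programme «Milne 1999 §1 on the abstract polarized `ℚ`-Hodge
structure, on `K`-points». Milne's proof of Proposition 3.3 (the degree-`2` case of "Lefschetz classes are the
`S(A)`-invariants") has two steps: "`ψ` is invariant under `S(A)` iff `ψ ∘ (γ × 1) = ψ ∘ (1 × γ†)`" and "**the `k`-algebra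
`C(A)` is generated by the `γ ∈ S(A)(k)`**" — the latter from Lemma 3.5 (every semisimple algebra with involution over an
ALGEBRAICALLY CLOSED field is generated by its unitary elements). For the Betti cohomology of a complex abelian variety, and
for every polarized `ℚ`-Hodge structure `(H, Q)` of the tree, the generation statement holds ALREADY OVER `ℚ` and over every
field `K ⊇ ℚ`, because the Hodge group sits inside `S(H)` (g18-#1 `hodgeGroup[BaseChange]_le_lefschetzGroup[BaseChange]`) and
generates the full centraliser `C(H) = End_{E_φ}(V)` (`ℚ[Hg(H)(ℚ)] = C(H)`, `K[Hg(H)(K)] = C(H) ⊗ K` for polarizable `H`: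
`Motives/HodgeGroupEnvelopingAlgebraPoints`, Jacobson density on rational points). This file records that, and its
consequence "the operators commuting with `S(H)` are the Hodge endomorphisms" (the commutant of `S(H)(K)` is `E_φ ⊗ K`,
Remarks 1.2 / 1.6 with `S(A)` in place of `C(A)`). Objects: `S(H)(ℚ) = Polarization.lefschetzGroup Q ≤ GL(V)`,
`S(H)(K) = Polarization.lefschetzGroupBaseChange K Q ≤ GL(K ⊗ V)`, `C(H) = Subalgebra.centralizer ℚ E_φ`, `E_φ = H.endAlg`
(g18-#1); `ℚ[·]`, `K[·]` are Mathlib's `Algebra.adjoin`. The `ℂ`-points twin on `H¹(A(ℂ); ℂ)` (`Milne1999/LefschetzCentraliser*`)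
and the torus twin (`Kaehler/ComplexTorusLefschetzGroup*`) are OTHER carriers, BY NAME.

## The source, verbatim

J. S. Milne, *Lefschetz classes on abelian varieties*, Duke Math. J. **96** (1999) 639–675 [Milne1999LefschetzClasses]
(held `paper:doi-10-1215-s0012-7094-99-09620-5`, author's folios; Duke page ≈ folio + 638):
* §3 p0015 L24–L31 (p. 653): "**Theorem 3.2.** For any abelian variety `A` over `Ω` and integer `r ≥ 0`, the `k`-algebra
  `H*(A^r)^{S(A)}` is generated by divisor classes. […] **Proposition 3.3.** […] the `k`-vector space `H²(A^r)^{S(A)}` is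
  generated by divisor classes."
* §3 p0015 L36–L46 (p. 653): "because `γ†γ = 1` for `γ ∈ S(A)(k)`, `ψ` is invariant under `S(A)` if and only if
  `ψ ∘ (γ × 1) = ψ ∘ (1 × γ†)`, all `γ ∈ S(A)(k)`. **The next lemma shows that the `k`-algebra `C(A)` is generated by the
  `γ ∈ S(A)(k)`**, and so Proposition 3.3 follows from Proposition 1.3. **Lemma 3.5.** Any semisimple algebra with
  involution `(R, †)` of finite dimension over an algebraically closed field `k` is generated (as a `k`-algebra) by the
  subset `U` of elements `u` satisfying `u†u = 1`."
* §1 p0005 L30–L32 (p. 643): "**Remark 1.2.** […] the centralizer of `C(A)` in `End_k(V(A))` is `End⁰(A) ⊗_ℚ k`";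
  p0006 L30–L34 (p. 644): "**Remark 1.6.** […] `C'(A) ≅ C(A) ⊗_k k'`, `S'(A) ≅ S(A)_{/k'}`."

## What is PROVED (every POLARIZED pure `ℚ`-HS `(H, Q)`, `V` finite-dimensional; every field `K ⊇ ℚ`, any universe)

* §1 **`ℚ`-points**: `ℚ[S(H)(ℚ)] ⊆ C(H)` (`Polarization.adjoin_lefschetzGroup_le_centralizer_endAlg`, no polarization
  needed beyond the definition), `ℚ[Hg(H)(ℚ)] ⊆ ℚ[S(H)(ℚ)]`, hence **`ℚ[S(H)(ℚ)] = C(H)`**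
  (`Polarization.adjoin_lefschetzGroup_eq_centralizer_endAlg`) and `ℚ[S(H)(ℚ)] = ℚ[Hg(H)(ℚ)]`; the commutant:
  **`End_ℚ(V)^{S(H)(ℚ)} = E_φ`** (`Polarization.forall_lefschetzGroup_comm_iff_mem_endAlg`,
  `Polarization.endAlg_eq_centralizer_image_coe_lefschetzGroup`).
* §2 **`K`-points**: `S(H)(K) ⊆ K[Hg(H)(K)]` (`Polarization.coe_mem_adjoin_hodgeGroupBaseChange_of_mem_lefschetzGroupBaseChange`),
  **`K[S(H)(K)] = K[Hg(H)(K)]`** (`Polarization.adjoin_lefschetzGroupBaseChange_eq_adjoin_hodgeGroupBaseChange`) with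
  underlying `K`-submodule `C(H) ⊗ K := span_K {c_K : c ∈ C(H)}`
  (`Polarization.adjoin_lefschetzGroupBaseChange_toSubmodule_eq_span`); the commutant: **`End_K(K ⊗ V)^{S(H)(K)} = E_φ ⊗ K`**
  (`Polarization.forall_lefschetzGroupBaseChange_comm_iff_mem_span_baseChange_endAlg`).

NOT here: Lemma 3.5 itself (semisimple algebras with involution over algebraically closed fields), Propositions 3.3 /
3.4 and Theorem 3.2 (divisor classes, invariant theory), the bilinear-form step (g18-#2
`Motives/HodgeStructureCentralizerEquivariantForms`: `forall_lefschetzGroup_form_apply_apply_iff_forall_centralizer`).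

## References

* [Milne1999LefschetzClasses] J. S. Milne, *Lefschetz classes on abelian varieties*, Duke Math. J. 96 (1999) 639–675, §3
  p. 653 (Theorem 3.2, Proposition 3.3, proof, Lemma 3.5), §1 Remarks 1.2 and 1.6.
* [Deligne1982HodgeCycles] P. Deligne, *Hodge cycles on abelian varieties*, LNM 900 (1982), I §5 Prop. 5.1 (proof: "`E` is
  the commutant of `G`").
* [BourbakiAlgebreVIII2012] N. Bourbaki, *Algèbre VIII*, §5 no 5 Thm. 3 (Jacobson density; behind `ℚ[Hg(H)(ℚ)] = C(H)`).
-/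

noncomputable section

open TensorProduct

namespace Literature.AlgebraicGeometry.Motives

namespace HodgeStructure

universe u uK

variable {V : Type u} [AddCommGroup V] [Module ℚ V] {n : ℤ} {H : HodgeStructure V n} (Q : Polarization H)

/-! ## §1 `ℚ`-points: `ℚ[S(H)(ℚ)] = ℚ[Hg(H)(ℚ)] = C(H)` and `End_ℚ(V)^{S(H)(ℚ)} = E_φ` -/

section RationalPoints

/-- **`ℚ[S(H)(ℚ)] ⊆ C(H)`**: the `ℚ`-algebra generated by `S(H)(ℚ)` lies in the centraliser of `E_φ` ("`γ ∈ C(A)`" for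
`γ ∈ S(A)(ℚ)`, and `C(A)` is a `ℚ`-algebra). [cite: Milne1999LefschetzClasses, §1 p. 644 L16–L18 and §3 p. 653 L44–L45] -/
theorem Polarization.adjoin_lefschetzGroup_le_centralizer_endAlg :
    Algebra.adjoin ℚ ((fun g : V ≃ₗ[ℚ] V ↦ (g : Module.End ℚ V)) '' (Q.lefschetzGroup : Set (V ≃ₗ[ℚ] V))) ≤
      Subalgebra.centralizer ℚ (H.endAlg : Set (Module.End ℚ V)) := by
  refine Algebra.adjoin_le ?_
  rintro _ ⟨g, hg, rfl⟩
  exact (forall_endAlg_apply_iff_coe_mem_centralizer_endAlg H g).1 hg.1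

variable [Module.Finite ℚ V] [HodgeTensorFacts.{u, u}]

/-- `ℚ[Hg(H)(ℚ)] ⊆ ℚ[S(H)(ℚ)]` (`Hg(H)(ℚ) ⊆ S(H)(ℚ)`, g18-#1). [cite: Milne1999LefschetzClasses, §4 p. 660 ("L(A) ⊃ Hg(A)")] -/
theorem Polarization.adjoin_hodgeGroup_le_adjoin_lefschetzGroup :
    Algebra.adjoin ℚ ((fun g : V ≃ₗ[ℚ] V ↦ (g : Module.End ℚ V)) '' (H.hodgeGroup : Set (V ≃ₗ[ℚ] V))) ≤
      Algebra.adjoin ℚ ((fun g : V ≃ₗ[ℚ] V ↦ (g : Module.End ℚ V)) '' (Q.lefschetzGroup : Set (V ≃ₗ[ℚ] V))) :=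
  Algebra.adjoin_mono (Set.image_mono fun _ hg ↦ Q.hodgeGroup_le_lefschetzGroup hg)

/-- **"the `k`-algebra `C(A)` is generated by the `γ ∈ S(A)(k)`", over `k = ℚ`: `ℚ[S(H)(ℚ)] = C(H)`** for every polarized
`ℚ`-Hodge structure — no algebraic closure needed, since already `ℚ[Hg(H)(ℚ)] = C(H)` (the tree's
`adjoin_hodgeGroup_eq_centralizer_endAlg`, Jacobson density on rational points) and `Hg(H)(ℚ) ⊆ S(H)(ℚ) ⊆ C(H)`.
[cite: Milne1999LefschetzClasses, §3 p. 653 L44–L45 and Lemma 3.5] [cite: Deligne1982HodgeCycles, I §5 Prop. 5.1 (proof)] -/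
theorem Polarization.adjoin_lefschetzGroup_eq_centralizer_endAlg :
    Algebra.adjoin ℚ ((fun g : V ≃ₗ[ℚ] V ↦ (g : Module.End ℚ V)) '' (Q.lefschetzGroup : Set (V ≃ₗ[ℚ] V))) =
      Subalgebra.centralizer ℚ (H.endAlg : Set (Module.End ℚ V)) :=
  le_antisymm Q.adjoin_lefschetzGroup_le_centralizer_endAlg
    ((adjoin_hodgeGroup_eq_centralizer_endAlg H ⟨Q⟩).symm.le.trans Q.adjoin_hodgeGroup_le_adjoin_lefschetzGroup)

/-- `ℚ[S(H)(ℚ)] = ℚ[Hg(H)(ℚ)]`: the Lefschetz group and the Hodge group generate the same `ℚ`-algebra of endomorphisms (both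
generate `C(H)`). [cite: Milne1999LefschetzClasses, §3 p. 653 L44–L45] [cite: Deligne1982HodgeCycles, I §5 Prop. 5.1 (proof)] -/
theorem Polarization.adjoin_lefschetzGroup_eq_adjoin_hodgeGroup :
    Algebra.adjoin ℚ ((fun g : V ≃ₗ[ℚ] V ↦ (g : Module.End ℚ V)) '' (Q.lefschetzGroup : Set (V ≃ₗ[ℚ] V))) =
      Algebra.adjoin ℚ ((fun g : V ≃ₗ[ℚ] V ↦ (g : Module.End ℚ V)) '' (H.hodgeGroup : Set (V ≃ₗ[ℚ] V))) := by
  rw [Q.adjoin_lefschetzGroup_eq_centralizer_endAlg, adjoin_hodgeGroup_eq_centralizer_endAlg H ⟨Q⟩]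

/-- **`End_ℚ(V)^{S(H)(ℚ)} = E_φ`: a rational endomorphism commutes with every element of `S(H)(ℚ)` iff it is a Hodge
endomorphism** ("⟸" is the definition of `S(H)`; "⟹" restricts to `Hg(H)(ℚ) ⊆ S(H)(ℚ)` and uses the tree's
`End_HS(H) = End_ℚ(V)^{Hg(H)(ℚ)}`; equivalently Remark 1.2, the commutant of `C(H) = ℚ[S(H)(ℚ)]` is `E_φ`).
[cite: Milne1999LefschetzClasses, §1 Remark 1.2 (p. 643) and §3 p. 653 L44–L45] [cite: Deligne1982HodgeCycles, I §5 Prop. 5.1 (proof)] -/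
theorem Polarization.forall_lefschetzGroup_comm_iff_mem_endAlg (a : Module.End ℚ V) :
    (∀ g ∈ Q.lefschetzGroup, a ∘ₗ (g : V →ₗ[ℚ] V) = (g : V →ₗ[ℚ] V) ∘ₗ a) ↔ a ∈ H.endAlg := by
  constructor
  · intro h
    exact (mem_endAlg_iff_forall_hodgeGroup H a).2 fun g hg ↦ h g (Q.hodgeGroup_le_lefschetzGroup hg)
  · intro ha g hg
    exact LinearMap.ext fun v ↦ hg.1 ⟨a, ha⟩ v

/-- **`E_φ` is the centralizer of `S(H)(ℚ)` in `End_ℚ(V)`** (as `ℚ`-subalgebras; the tree's `endAlg_eq_centralizer_hodgeGroup` is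
the Hodge-group form). [cite: Milne1999LefschetzClasses, §1 Remark 1.2 (p. 643) and §3 p. 653 L44–L45] -/
theorem Polarization.endAlg_eq_centralizer_image_coe_lefschetzGroup :
    H.endAlg = Subalgebra.centralizer ℚ ((fun g : V ≃ₗ[ℚ] V ↦ (g : Module.End ℚ V)) '' (Q.lefschetzGroup : Set (V ≃ₗ[ℚ] V))) := by
  refine Subalgebra.ext fun a ↦ ?_
  rw [← Q.forall_lefschetzGroup_comm_iff_mem_endAlg, Subalgebra.mem_centralizer_iff]
  constructor
  · rintro h _ ⟨g, hg, rfl⟩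
    exact (h g hg).symm
  · intro h g hg
    exact (h _ ⟨g, hg, rfl⟩).symm

end RationalPoints

/-! ## §2 `K`-points: `K[S(H)(K)] = K[Hg(H)(K)]`, with `K`-span `C(H) ⊗ K`, and `End_K(K ⊗ V)^{S(H)(K)} = E_φ ⊗ K` -/

section Points

variable (K : Type uK) [Field K] [Algebra ℚ K] [Module.Finite ℚ V]

omit [Module.Finite ℚ V] in
/-- A `K`-linear combination of the `a_K`, `a ∈ E_φ`, commutes with any `g` commuting with every `a_K`. Private plumbing. [folklore] -/
private theorem mul_comm_of_mem_span_range_baseChange {f : Module.End K (K ⊗[ℚ] V)}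
    (hf : f ∈ Submodule.span K (Set.range fun a : H.endAlg ↦ (a : Module.End ℚ V).baseChange K))
    {g : Module.End K (K ⊗[ℚ] V)} (hg : ∀ a : H.endAlg, (a : Module.End ℚ V).baseChange K * g = g * (a : Module.End ℚ V).baseChange K) :
    f * g = g * f := by
  induction hf using Submodule.span_induction with
  | mem f h =>
    obtain ⟨a, rfl⟩ := h
    exact hg a
  | zero => rw [zero_mul, mul_zero]
  | add f f' _ _ hf hf' => rw [add_mul, mul_add, hf, hf']
  | smul c f _ hf => rw [smul_mul_assoc, mul_smul_comm, hf]

variable [HodgeTensorFacts.{u, u}]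

variable {K} in
/-- **`S(H)(K) ⊆ K[Hg(H)(K)]`**: an element of the Lefschetz group lies in the `K`-algebra generated by the `K`-points of the
Hodge group (`γ ∈ C(H) ⊗ K`, g18-#1, and `C(H) ⊗ K` is the underlying module of `K[Hg(H)(K)]`, the tree's
`adjoin_hodgeGroupBaseChange_toSubmodule_eq_span`). [cite: Milne1999LefschetzClasses, §3 p. 653 L44–L45 and §1 Remark 1.6] -/
theorem Polarization.coe_mem_adjoin_hodgeGroupBaseChange_of_mem_lefschetzGroupBaseChange
    {γ : (K ⊗[ℚ] V) ≃ₗ[K] (K ⊗[ℚ] V)} (hγ : γ ∈ Q.lefschetzGroupBaseChange K) :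
    (γ : Module.End K (K ⊗[ℚ] V)) ∈ Algebra.adjoin K ((fun γ' : (K ⊗[ℚ] V) ≃ₗ[K] (K ⊗[ℚ] V) ↦ (γ' : Module.End K (K ⊗[ℚ] V))) ''
      (H.hodgeGroupBaseChange K : Set ((K ⊗[ℚ] V) ≃ₗ[K] (K ⊗[ℚ] V)))) := by
  rw [← Subalgebra.mem_toSubmodule, adjoin_hodgeGroupBaseChange_toSubmodule_eq_span H K ⟨Q⟩]
  exact Q.coe_mem_span_baseChange_centralizer_endAlg_of_mem_lefschetzGroupBaseChange hγ

/-- **`K[S(H)(K)] = K[Hg(H)(K)]`** for every field `K ⊇ ℚ`: the `K`-points of the Lefschetz group and of the Hodge group generate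
the same `K`-algebra of endomorphisms of `K ⊗ V` ("the `k`-algebra `C(A)` is generated by the `γ ∈ S(A)(k)`" together with
`K[Hg(H)(K)] = C(H) ⊗ K`; no algebraic closure). [cite: Milne1999LefschetzClasses, §3 p. 653 L44–L45, Lemma 3.5 and §1 Remark 1.6]
[cite: Deligne1982HodgeCycles, I §5 Prop. 5.1 (proof)] -/
theorem Polarization.adjoin_lefschetzGroupBaseChange_eq_adjoin_hodgeGroupBaseChange :
    Algebra.adjoin K ((fun γ : (K ⊗[ℚ] V) ≃ₗ[K] (K ⊗[ℚ] V) ↦ (γ : Module.End K (K ⊗[ℚ] V))) ''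
        (Q.lefschetzGroupBaseChange K : Set ((K ⊗[ℚ] V) ≃ₗ[K] (K ⊗[ℚ] V)))) =
      Algebra.adjoin K ((fun γ : (K ⊗[ℚ] V) ≃ₗ[K] (K ⊗[ℚ] V) ↦ (γ : Module.End K (K ⊗[ℚ] V))) ''
        (H.hodgeGroupBaseChange K : Set ((K ⊗[ℚ] V) ≃ₗ[K] (K ⊗[ℚ] V)))) := by
  refine le_antisymm (Algebra.adjoin_le ?_) (Algebra.adjoin_mono (Set.image_mono fun _ hγ ↦
    Q.hodgeGroupBaseChange_le_lefschetzGroupBaseChange K hγ))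
  rintro _ ⟨γ, hγ, rfl⟩
  exact Q.coe_mem_adjoin_hodgeGroupBaseChange_of_mem_lefschetzGroupBaseChange hγ

/-- **`K[S(H)(K)]` has underlying `K`-module `C(H) ⊗ K`**, the `K`-span of the base changes `c_K`, `c ∈ C(H)` ("`C'(A) ≅ C(A) ⊗_k k'`
is generated by `S'(A)(k')`"). [cite: Milne1999LefschetzClasses, §1 Remark 1.6 (p. 644) and §3 p. 653 L44–L45] -/
theorem Polarization.adjoin_lefschetzGroupBaseChange_toSubmodule_eq_span :
    Subalgebra.toSubmodule (Algebra.adjoin K ((fun γ : (K ⊗[ℚ] V) ≃ₗ[K] (K ⊗[ℚ] V) ↦ (γ : Module.End K (K ⊗[ℚ] V))) ''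
        (Q.lefschetzGroupBaseChange K : Set ((K ⊗[ℚ] V) ≃ₗ[K] (K ⊗[ℚ] V))))) =
      Submodule.span K ((fun c : Module.End ℚ V ↦ c.baseChange K) ''
        (Subalgebra.centralizer ℚ (H.endAlg : Set (Module.End ℚ V)) : Set (Module.End ℚ V))) := by
  rw [Q.adjoin_lefschetzGroupBaseChange_eq_adjoin_hodgeGroupBaseChange K, adjoin_hodgeGroupBaseChange_toSubmodule_eq_span H K ⟨Q⟩]

/-- **`End_K(K ⊗ V)^{S(H)(K)} = E_φ ⊗ K`: a `K`-linear endomorphism of `K ⊗ V` commutes with every element of `S(H)(K)` iff it is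
a `K`-linear combination of base-changed Hodge endomorphisms `a_K`, `a ∈ E_φ`** ("⟸": `S(H)(K)` commutes with each `a_K` by
definition; "⟹": an operator commuting with `S(H)(K)` commutes with `K[S(H)(K)] ∋ c_K` for every `c ∈ C(H)`, and the commutant
of `C(H) ⊗ K` is `E_φ ⊗ K` — Remark 1.2 on `K`-points, g18-#1). [cite: Milne1999LefschetzClasses, §1 Remark 1.2 (p. 643), Remark 1.6 (p. 644) and §3 p. 653 L44–L45] -/
theorem Polarization.forall_lefschetzGroupBaseChange_comm_iff_mem_span_baseChange_endAlg (f : Module.End K (K ⊗[ℚ] V)) :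
    (∀ γ ∈ Q.lefschetzGroupBaseChange K, f * (γ : Module.End K (K ⊗[ℚ] V)) = (γ : Module.End K (K ⊗[ℚ] V)) * f) ↔
      f ∈ Submodule.span K (Set.range fun a : H.endAlg ↦ (a : Module.End ℚ V).baseChange K) := by
  constructor
  · intro h
    -- `f` commutes with the generators of `K[S(H)(K)]`, hence with the whole algebra, whose underlying module contains every `c_K`
    have hle : Algebra.adjoin K ((fun γ : (K ⊗[ℚ] V) ≃ₗ[K] (K ⊗[ℚ] V) ↦ (γ : Module.End K (K ⊗[ℚ] V))) ''
        (Q.lefschetzGroupBaseChange K : Set ((K ⊗[ℚ] V) ≃ₗ[K] (K ⊗[ℚ] V)))) ≤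
          Subalgebra.centralizer K ({f} : Set (Module.End K (K ⊗[ℚ] V))) := by
      refine Algebra.adjoin_le ?_
      rintro _ ⟨γ, hγ, rfl⟩
      rw [SetLike.mem_coe, Subalgebra.mem_centralizer_iff]
      intro g hg
      rw [Set.mem_singleton_iff.1 hg]
      exact h γ hγ
    refine (forall_centralizer_endAlg_baseChange_comm_iff_mem_span_baseChange_endAlg K H ⟨Q⟩ f).1 fun c hc ↦ ?_
    have hcK : c.baseChange K ∈ Subalgebra.centralizer K ({f} : Set (Module.End K (K ⊗[ℚ] V))) := by
      refine hle ?_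
      rw [← Subalgebra.mem_toSubmodule, Q.adjoin_lefschetzGroupBaseChange_toSubmodule_eq_span K]
      exact Submodule.subset_span ⟨c, hc, rfl⟩
    rw [Subalgebra.mem_centralizer_iff] at hcK
    exact hcK f (Set.mem_singleton f)
  · intro hf γ hγ
    exact mul_comm_of_mem_span_range_baseChange K hf fun a ↦ LinearMap.ext fun x ↦ hγ.1 a x

/-- **`E_φ ⊗ K` is the centralizer of `S(H)(K)` in `End_K(K ⊗ V)`**, as `K`-submodules: the underlying module of the commutant of
`S(H)(K)` is the `K`-span of the `a_K`, `a ∈ E_φ`. [cite: Milne1999LefschetzClasses, §1 Remark 1.2 (p. 643), Remark 1.6 (p. 644) and §3 p. 653 L44–L45] -/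
theorem Polarization.centralizer_image_coe_lefschetzGroupBaseChange_toSubmodule_eq_span :
    Subalgebra.toSubmodule (Subalgebra.centralizer K ((fun γ : (K ⊗[ℚ] V) ≃ₗ[K] (K ⊗[ℚ] V) ↦ (γ : Module.End K (K ⊗[ℚ] V))) ''
        (Q.lefschetzGroupBaseChange K : Set ((K ⊗[ℚ] V) ≃ₗ[K] (K ⊗[ℚ] V))))) =
      Submodule.span K (Set.range fun a : H.endAlg ↦ (a : Module.End ℚ V).baseChange K) := by
  ext f
  rw [Subalgebra.mem_toSubmodule, Subalgebra.mem_centralizer_iff,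
    ← Q.forall_lefschetzGroupBaseChange_comm_iff_mem_span_baseChange_endAlg K f]
  constructor
  · intro h γ hγ
    exact (h _ ⟨γ, hγ, rfl⟩).symm
  · rintro h _ ⟨γ, hγ, rfl⟩
    exact (h γ hγ).symm

end Points

end HodgeStructure

end Literature.AlgebraicGeometry.Motives
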